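import Literature.MathematicalPhysics.QuantumFieldTheory.Balaban1983to89.B11LeafUnpinnedRecord
import Summits.QuantumFields.YangMills.Theorems.BalabanUVNodesClustersCore

/-!
# DAG node N07 · [B11] — THE STUB OF RECORD `YMDAG.UVSplit.S_N07 Rec := AtRecord Rec Dag.B11_main` READ AT NODE 00's RECORD PREDICATES
# OF RECORD: at `Rec := IsRecordOfRecord₅C` (resp. `₈C`) it is REFUTABLE as typed (the [B11] bundle is the residual `θ.res.Z P`), it is PRECISELY
# «the world's `b11` leaf at every ₅C record» modulo the leaves `b8 b9`, and it HOLDS for every record predicate that refines ₅C AND pins that leaf —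
# the Summits-side face, in cluster K3's own vocabulary, of `Balaban1983to89.B11LeafUnpinnedRecord` (Literature, same seat)

Cell `pub-ymgap`, YM-PLAN Track A (HUMAN RULING D-0062), seat `pub-ymgap-dag-n07-a` (gen 2; -a KNIT-BY-NAME seat of node N07 = [Balaban1985Variational]
Thm 1 p. 279 + Props 2–9 pp. 281–309, statement of record `Dag.B11_main (DagBinding.leavesP w P)`).  The route module `BalabanUVNodesClustersCore`
(courier dag-p2, dagwriter's UVSplit cut R420 (C)) types every paper-node stub as `AtRecord Rec Dag.<Bk>_main` over a record-predicate PARAMETER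
`Rec : RecordPred N`; cluster K3 «RenormalisationBeta» takes `h7 : S_N07 Rec`.  This file answers, for N07, the question «at which `Rec` is the stub a
sound statement?» with the tree's record predicates of record (`Node00.IsRecordOfRecord₅C`, chair R434 (Q2) = (C); its Stage-8 refinement
`Node00.IsRecordOfRecord₈C`).  THEOREMS ONLY (0 `def`, 0 `sorry`, standard axioms); `--supports stmt-QuantumFields-19183`.

WHAT IS PROVED.
* `s_N07_iff_leaves_record₅C ∕ ₈C` — at the ₅C ∕ ₈C predicate the stub IS «for every record and run, `b8 → b9 → b11` of the world's binding» (the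
  antecedents `b5 b6 b7` are theorems of the record, N03 outright R443: `B11LeafUnpinnedRecord.b11_main_iff_of_isRecordOfRecord₅C`).
* **`not_s_N07_record₅C`** — the stub at `Rec := IsRecordOfRecord₅C` is FALSE (`B11LeafUnpinnedRecord.b11_main_undetermined_over_record₅C` on the
  family `L = 13, m = 1`); **`not_s_N07_record₈C`** — the same at `₈C`, relative to one ₈C record on some family (`exists_record₈C_not_b11_main`).
  Hence K3's hypothesis `h7 : S_N07 Rec` is UNSATISFIABLE at the record predicates of record as they stand: a B11-PINNING stage (NODE 00 Stage 3′(Z),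
  `res.Z := Z11OfRecord θ P`) must come first (design note `HOME/pub-ymgap-dag-n07-a/B11-PIN-SOCKET.md`; Theorem-1 family `Balaban1983to89.B11Thm1CarrierT`).
* **`s_N07_of_refines_of_leaf`** — the REPAIR SHAPE: for every record predicate `Rec` that refines ₅C and at which the world's `b11` leaf holds (what a
  pinning stage's theorem `B11Leaf (Z11OfRecord θ P)` supplies), `S_N07 Rec` holds; `s_N07_of_refines₈C_of_leaf` likewise through ₈C.
* `s_N07_record₅C_and` — the conjunction-refined predicate «₅C ∧ the world's `b11` leaf at every run» satisfies the stub (trivial instance of the repair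
  shape; NOT a proposal for the pin — the leaf must come from objects, ref-C (a)).

HONEST FRAMING: count-neutral bookkeeping over the route's stub and NODE 00's predicates; N07 NOT discharged; nothing of Bałaban's asserted; one finite
four-torus programme at fixed `ε`; nothing continuum ∕ ℝ⁴ ∕ OS ∕ mass-gap ∕ Clay.
-/

noncomputable section

namespace Summit.QuantumFields.YangMills.Theorems.BalabanUVNodesN07RecordCensus

open Literature.MathematicalPhysics.QuantumFieldTheory.Balaban1983to89
open Literature.MathematicalPhysics.QuantumFieldTheory.Balaban1983to89.T4Continuum (T4Family FiniteEpsData)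
open Literature.MathematicalPhysics.QuantumFieldTheory.Balaban1983to89.DagBinding (WorldP leavesP)
open Literature.MathematicalPhysics.QuantumFieldTheory.Balaban1983to89.Node00 (IsRecordOfRecord₅C IsRecordOfRecord₈C isRecordOfRecord₅C_of_isRecordOfRecord₈C)
open Literature.MathematicalPhysics.QuantumFieldTheory.Balaban1983to89.B11LeafUnpinnedRecord
open YMDAG.UVSplit (RecordPred AtRecord S_N07)

variable (N : ℕ) [NeZero N]

/-! ## §1 The stub at the record predicates of record IS the world's leaf modulo `b8 b9` -/

/-- **At `Rec := IsRecordOfRecord₅C` the stub `S_N07` IS «`b8 → b9 → b11` of the world's binding at every record and run».**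
[cite: Balaban1985Variational, Thm 1 p.279, Props 2–9 pp.281–309 (bookkeeping: the node at NODE 00's record predicate of record)] -/
theorem s_N07_iff_leaves_record₅C :
    S_N07 (fun F D w => IsRecordOfRecord₅C F N D w) ↔
      ∀ (F : T4Family) (D : FiniteEpsData F (Node00.SU N)) (w : WorldP), IsRecordOfRecord₅C F N D w →
        ∀ P : B12.RunParams, (leavesP w P).b8 → (leavesP w P).b9 → (leavesP w P).b11 :=
  ⟨fun h F D w hR P => (b11_main_iff_of_isRecordOfRecord₅C hR P).1 (h F D w hR P),
    fun h F D w hR P => (b11_main_iff_of_isRecordOfRecord₅C hR P).2 (h F D w hR P)⟩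

/-- The same at the Stage-8 refinement `IsRecordOfRecord₈C`. [cite: Balaban1985Variational, Thm 1 p.279, Props 2–9 pp.281–309 (bookkeeping)] -/
theorem s_N07_iff_leaves_record₈C :
    S_N07 (fun F D w => IsRecordOfRecord₈C F N D w) ↔
      ∀ (F : T4Family) (D : FiniteEpsData F (Node00.SU N)) (w : WorldP), IsRecordOfRecord₈C F N D w →
        ∀ P : B12.RunParams, (leavesP w P).b8 → (leavesP w P).b9 → (leavesP w P).b11 :=
  ⟨fun h F D w hR P => (b11_main_iff_of_isRecordOfRecord₈C hR P).1 (h F D w hR P),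
    fun h F D w hR P => (b11_main_iff_of_isRecordOfRecord₈C hR P).2 (h F D w hR P)⟩

/-! ## §2 The stub is refutable at the record predicates as they stand -/

/-- **`S_N07` at `Rec := IsRecordOfRecord₅C` is FALSE**: on the four-torus family `L = 13, m = 1` there is a ₅C record at every run of which N07 fails
(`B11LeafUnpinnedRecord.b11_main_undetermined_over_record₅C`).  Cluster K3's hypothesis `h7` is unsatisfiable at this `Rec`.
[cite: Balaban1985Variational, Thm 1 p.279 (bookkeeping: the universal form over the unpinned record is refutable)] -/
theorem not_s_N07_record₅C : ¬ S_N07 (fun F D w => IsRecordOfRecord₅C F N D w) := by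
  intro h
  let F13 : T4Family := ⟨13, ⟨⟨6, rfl⟩, by norm_num⟩, by norm_num, 1, le_rfl⟩
  obtain ⟨-, D, w, hw, hnot⟩ := b11_main_undetermined_over_record₅C F13 N
  exact hnot ⟨0, F13.m, 1⟩ (h F13 D w hw _)

/-- **`S_N07` at `Rec := IsRecordOfRecord₈C` is FALSE as soon as one ₈C record exists on some family** (e.g. by seat dag-n23-b's `Node00/Record8Inhabited`):
`B11LeafUnpinnedRecord.exists_record₈C_not_b11_main`. [cite: Balaban1985Variational, Thm 1 p.279 (bookkeeping: the universal form over the unpinned Stage-8 record is refutable)] -/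
theorem not_s_N07_record₈C (hex : ∃ (F : T4Family) (D : FiniteEpsData F (Node00.SU N)) (w : WorldP), IsRecordOfRecord₈C F N D w) :
    ¬ S_N07 (fun F D w => IsRecordOfRecord₈C F N D w) := by
  intro h
  obtain ⟨F, D, w, hw⟩ := hex
  obtain ⟨w', hw', hnot⟩ := exists_record₈C_not_b11_main hw
  exact hnot ⟨0, F.m, 1⟩ (h F D w' hw' _)

/-! ## §3 The repair shape: refine ₅C and pin the leaf -/

/-- **THE REPAIR SHAPE** — `S_N07 Rec` holds for every record predicate `Rec` that (i) refines `IsRecordOfRecord₅C` and (ii) carries the world's own `b11`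
leaf at every run (what a B11-pinning stage's theorem `B11Leaf (Z11OfRecord θ P)` supplies through
`B11LeafUnpinnedRecord.forall_pinned_b11Leaf_iff₅C`). [cite: Balaban1985Variational, Thm 1 p.279, Props 2–9 pp.281–309 (bookkeeping: the pinned socket)] -/
theorem s_N07_of_refines_of_leaf (Rec : RecordPred N)
    (hRec : ∀ (F : T4Family) (D : FiniteEpsData F (Node00.SU N)) (w : WorldP), Rec F D w → IsRecordOfRecord₅C F N D w)
    (hleaf : ∀ (F : T4Family) (D : FiniteEpsData F (Node00.SU N)) (w : WorldP), Rec F D w → ∀ P : B12.RunParams, (leavesP w P).b11) :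
    S_N07 Rec :=
  fun F D w hR P => b11_main_of_isRecordOfRecord₅C_of_leaf (hRec F D w hR) (hleaf F D w hR) P

/-- The repair shape through the Stage-8 refinement. [cite: Balaban1985Variational, Thm 1 p.279, Props 2–9 pp.281–309 (bookkeeping)] -/
theorem s_N07_of_refines₈C_of_leaf (Rec : RecordPred N)
    (hRec : ∀ (F : T4Family) (D : FiniteEpsData F (Node00.SU N)) (w : WorldP), Rec F D w → IsRecordOfRecord₈C F N D w)
    (hleaf : ∀ (F : T4Family) (D : FiniteEpsData F (Node00.SU N)) (w : WorldP), Rec F D w → ∀ P : B12.RunParams, (leavesP w P).b11) :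
    S_N07 Rec :=
  s_N07_of_refines_of_leaf N Rec (fun F D w hR => isRecordOfRecord₅C_of_isRecordOfRecord₈C (hRec F D w hR)) hleaf

/-- The trivial instance of the repair shape (NOT a pin proposal — the leaf must come from objects): the conjunction-refined predicate «₅C ∧ the world's
`b11` leaf at every run» satisfies the stub. [cite: Balaban1985Variational, Thm 1 p.279 (bookkeeping)] -/
theorem s_N07_record₅C_and :
    S_N07 (fun F D w => IsRecordOfRecord₅C F N D w ∧ ∀ P : B12.RunParams, (leavesP w P).b11) :=
  s_N07_of_refines_of_leaf N _ (fun _ _ _ h => h.1) (fun _ _ _ h => h.2)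

end Summit.QuantumFields.YangMills.Theorems.BalabanUVNodesN07RecordCensus
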